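import Summits.NavierStokesRegularity.NavierStokesRegularity.Theses.PlaneEnergyCeiling
import Literature.Analysis.FluidPDE.NSQuasipotential

/-!
# Disproof of `BoundedPlanarEnergyRegularity` — findings: NO KILL (crux-attack cycle 1); S → C only;
# zero datum "true → true"; the Leray–Hopf clause is load-bearing (LH-free variant vacuous)

Crux work file of `PlaneEnergyCeiling.BoundedPlanarEnergyRegularity` (stmt-NavierStokesRegularity-16921),
opened by the crux-attack seat `refuter-rattack-stmt-NavierStokesRegularity-16921-0`, 2026-08-17
(one cycle of basic attacks; there was no earlier Disproof.lean). Everything is sorry-free, standard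
axioms; there is no `NearMisses` section. §3 is also filed for the tree as
`Theorems/BoundedPlanarEnergyRegularity/Negative/LerayHopfClauseLoadBearing.lean` (proposal id in the
crux NOTES / item evidence). A later cdisprove seat EXTENDS this file (do not restart it).

Attacks run and their outcome (details in the item evidence note):
* elaboration rc 0 (by-name probe); `exact?` / `simp_all` / `aesop` do not close the crux; C → S fails
  `exact?` / `aesop` (needs `PlanarEnergyAPriori`, = `closes`); S → C is one line (§1);
* quantifier order: `∃ M` per `(T, u, p)` as intended; at a blow-up time `T*` the instance `T = T*`
  is available with `u(T*) :=` weak-`L²` limit (then `IsLerayHopfOn T*` holds), for `T > T*` the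
  inner class is empty (weak–strong uniqueness), for `T < T*` the bound is automatic — so the crux
  reads exactly "planar energies bounded up to the blow-up time ⇒ no blow-up" + local Clay theory;
* vacuity A1–A6: outer hypotheses satisfiable, inner class inhabited, inner hypothesis TRUE at
  `u₀ = 0`, conclusion = Clay (A)(u₀) (open in general, true at 0) (§2);
* missing normalisation: Galilean / parasitic drifts are excluded by the LH (finite-energy) clause;
  dropping it makes the inner hypothesis false at every datum and the crux vacuous (§3);
* junk: planar energy is an `lintegral` of `‖·‖ₑ²` over `volume` on `EuclideanSpace ℝ (Fin 2)` (no
  Bochner junk), `M : ℝ` under `ofReal` (harmless), `R` over all linear isometries (all planes);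
* cheapest falsifier: not finite/decidable — a kill needs a blow-up from a Fefferman datum with
  bounded planar energies (¬Clay (A) in particular); conversely `NavierStokesRegularity → Crux`, so
  the crux cannot be false unless Clay (A) is. No compute job.

Findings:
* §0 `crux_iff` — compact form `∀ ν > 0, ∀ Clay datum u₀, PlanarHyp ν u₀ → ClayA ν u₀` (Iff.rfl).
* §1 `crux_of_summit` — S → C: the crux is implied by the summit (its conclusion alone is Clay (A)
  for u₀); `summit_of_crux_and_apriori` — C → S is exactly the route's `closes` given the OTHER crux
  `PlanarEnergyAPriori`; C alone ↛ S by `exact?` / `aesop` (probe file W2.lean, recorded in NOTES).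
  So C is a genuine weakening of S (a regularity CRITERION in A-form), not a restatement.
* §2 degenerate datum `u₀ = 0`: the outer hypotheses are satisfiable (`0` is smooth, div-free,
  rapidly decaying); the inner class {classical on [0,T), Leray–Hopf on [0,T], u 0 = u₀} is
  INHABITED at u₀ = 0 by the rest state (`innerClass_zero`); the inner hypothesis `PlanarHyp ν 0`
  HOLDS (`planarHyp_zero`: by the energy inequality every Leray–Hopf field from 0 has zero energy,
  hence — being continuous — vanishes identically on [0,T), so all planar energies are 0); and the
  conclusion Clay (A)(0) holds by the rest state (`clayA_zero`). Instance = "true → true": neither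
  vacuous nor a counterexample.
* §3 LOAD-BEARING CLAUSE: drop `IsLerayHopfOn` from the inner hypothesis and it becomes FALSE already
  at u₀ = 0 (`not_planarHypWithoutLH_zero`): the accelerating Galilean drift `u(t,x) = t • e`,
  `p(t,x) = -⟪e, x⟫` is a classical solution on [0,T) from the zero datum with INFINITE planar energy
  at every t > 0. Hence the LH-free crux holds VACUOUSLY at 0 (`cruxWithoutLH_vacuous_at_zero`) and —
  by Galilean invariance applied to the local smooth solution — at every datum: the finite-energy
  (Leray–Hopf) clause is exactly what makes the criterion non-vacuous (it kills the parasitic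
  drifts), i.e. the "missing normalisation" attack is ANSWERED by the statement as written.
-/

noncomputable section

open MeasureTheory Set Function Filter Topology
open scoped InnerProductSpace RealInnerProductSpace ContDiff ENNReal Laplacian
open Literature.Analysis.FluidPDE

namespace Summit.NavierStokesRegularity.NavierStokesRegularity.Cruxes.BoundedPlanarEnergyRegularity.Disproof

set_option linter.unusedVariables false
set_option linter.dupNamespace false

/-- Physical space. -/
local notation "ℝ³" => EuclideanSpace ℝ (Fin 3)
/-- Plane coordinates. -/
local notation "ℝ²" => EuclideanSpace ℝ (Fin 2)

/-! ## §0 The crux by name and its compact form -/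

/-- The crux under attack, by name. -/
abbrev Crux : Prop :=
  Summit.NavierStokesRegularity.NavierStokesRegularity.Theses.PlaneEnergyCeiling.BoundedPlanarEnergyRegularity

/-- Planar kinetic energy of a field `w` through the plane `R({x₂ = c})` (inlined in the crux). -/
def planarEnergy (w : ℝ³ → ℝ³) (R : ℝ³ ≃ₗᵢ[ℝ] ℝ³) (c : ℝ) : ℝ≥0∞ :=
  ∫⁻ y : ℝ², ‖w (R (WithLp.toLp 2 ![y 0, y 1, c]))‖ₑ ^ 2

/-- Clay (A) for ONE datum `u₀` (the crux's conclusion; the summit is `∀ u₀, ClayA ν u₀`). -/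
def ClayA (ν : ℝ) (u₀ : ℝ³ → ℝ³) : Prop :=
  ∃ (u : ℝ → ℝ³ → ℝ³) (p : ℝ → ℝ³ → ℝ), IsSmoothOnHalfSpace u ∧ IsSmoothOnHalfSpace p ∧
    IsNavierStokesSolution ν 0 u₀ u p ∧ HasBoundedEnergy u

/-- The inner hypothesis of the crux: every classical solution on `[0,T)` that is Leray–Hopf on
`[0,T]` from `u 0 = u₀` has planar energies bounded on `[0,T)` (every `T > 0`). -/
def PlanarHyp (ν : ℝ) (u₀ : ℝ³ → ℝ³) : Prop :=
  ∀ (T : ℝ), 0 < T → ∀ (u : ℝ → ℝ³ → ℝ³) (p : ℝ → ℝ³ → ℝ),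
    IsClassicalNSSolutionOn (Set.Ico 0 T) ν 0 u p → IsLerayHopfOn T ν 0 (u 0) u → u 0 = u₀ →
    ∃ M : ℝ, ∀ t ∈ Set.Ico 0 T, ∀ (R : ℝ³ ≃ₗᵢ[ℝ] ℝ³) (c : ℝ), planarEnergy (u t) R c ≤ ENNReal.ofReal M

/-- **Compact form** (definitional read-back of the elaborated statement). -/
theorem crux_iff :
    Crux ↔ ∀ ν : ℝ, 0 < ν → ∀ u₀ : ℝ³ → ℝ³, ContDiff ℝ (⊤ : ℕ∞) u₀ → NSWave0.IsDivFree u₀ →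
      HasRapidSpatialDecay u₀ → PlanarHyp ν u₀ → ClayA ν u₀ :=
  Iff.rfl

/-! ## §1 Restates-the-summit probe -/

/-- **S → C**: the summit implies the crux (drop the planar hypothesis). -/
theorem crux_of_summit (hS : NavierStokesRegularity) : Crux :=
  fun ν hν u₀ hu₀ hdiv hdec _ => hS ν hν u₀ hu₀ hdiv hdec

/-- **C → S needs the other crux**: with `PlanarEnergyAPriori` this is the route's `closes`;
`C → S` alone fails `exact?`/`aesop` (probe W2.lean). -/
theorem summit_of_crux_and_apriori
    (h₁ : Summit.NavierStokesRegularity.NavierStokesRegularity.Theses.PlaneEnergyCeiling.PlanarEnergyAPriori)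
    (h₂ : Crux) : NavierStokesRegularity :=
  -- buildfix 2026-08-19: the route's `closes` is now 3-ary (APriori, Liouville, ZoomA) and derives the crux
  -- internally; this is its FIRST LAYER verbatim (crux + a-priori bound ⇒ summit), datum by datum.
  fun ν hν u₀ hu₀ hdiv hdec =>
    h₂ ν hν u₀ hu₀ hdiv hdec (fun T hT u p hcl hLH h0 => h₁ ν T hν hT u p hcl hLH (h0 ▸ hdec))

/-! ## §2 The degenerate datum `u₀ = 0`: hypotheses satisfiable, instance true → true -/

/-- The zero datum decays rapidly. -/
theorem hasRapidSpatialDecay_zero : HasRapidSpatialDecay (0 : ℝ³ → ℝ³) := fun n K =>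
  ⟨0, fun x => by
    have : iteratedFDeriv ℝ n (0 : ℝ³ → ℝ³) x = 0 := by
      rw [Pi.zero_def, iteratedFDeriv_fun_zero]; rfl
    rw [this, norm_zero, mul_zero]⟩

/-- The zero datum is divergence free (Wave-0 divergence). -/
theorem isDivFree_zero : NSWave0.IsDivFree (0 : ℝ³ → ℝ³) := fun x => by
  simp [NSWave0.divergence]

/-- The zero datum is smooth. -/
theorem contDiff_zero : ContDiff ℝ (⊤ : ℕ∞) (0 : ℝ³ → ℝ³) := contDiff_const

/-- The planar energies of the zero field vanish. -/
@[simp] theorem planarEnergy_zero (R : ℝ³ ≃ₗᵢ[ℝ] ℝ³) (c : ℝ) :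
    planarEnergy (0 : ℝ³ → ℝ³) R c = 0 := by
  simp [planarEnergy]

/-- **The inner class is inhabited at `u₀ = 0`**: the rest state is classical on `[0,T)` and
Leray–Hopf on `[0,T]` from the zero datum (in-tree `isClassicalNSSolutionOn_zero`,
`isLerayHopfOn_zero`). -/
theorem innerClass_zero (ν T : ℝ) :
    IsClassicalNSSolutionOn (Ico 0 T) ν 0 (0 : ℝ → ℝ³ → ℝ³) 0 ∧
      IsLerayHopfOn T ν 0 ((0 : ℝ → ℝ³ → ℝ³) 0) 0 ∧ (0 : ℝ → ℝ³ → ℝ³) 0 = 0 :=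
  ⟨isClassicalNSSolutionOn_zero _ _, by simpa using isLerayHopfOn_zero (E := ℝ³) T ν, rfl⟩

/-- **Energy uniqueness from rest**: a Leray–Hopf field (ν ≥ 0) from the zero datum whose slice
`u t` is continuous vanishes identically at every `t ∈ [0,T]` (energy inequality from `s = 0`:
`½‖u t‖² + ν·D ≤ ½‖0‖² + 0`, so `∫⁻ ‖u t‖ₑ² = 0`, so `u t = 0` a.e., so everywhere). -/
theorem eq_zero_of_isLerayHopfOn_zero_datum {ν T : ℝ} (hν : 0 ≤ ν) {u : ℝ → ℝ³ → ℝ³}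
    (hLH : IsLerayHopfOn T ν 0 0 u) {t : ℝ} (ht : t ∈ Icc 0 T) (hcont : Continuous (u t)) :
    u t = 0 := by
  obtain ⟨G, -, -, h0, -⟩ := hLH.weakGrad_energy
  have hineq := h0 t ht
  have hK0 : VectorCalculus.kineticEnergy (0 : ℝ³ → ℝ³) = 0 := by
    simp [VectorCalculus.kineticEnergy]
  simp only [hK0, Pi.zero_apply, inner_zero_left, integral_zero, intervalIntegral.integral_zero,
    add_zero] at hineq
  have hD : 0 ≤ ν * (∫⁻ τ in Ioo 0 t, ∫⁻ x, ENNReal.ofReal (frobeniusNormSq (G τ x))).toReal :=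
    mul_nonneg hν ENNReal.toReal_nonneg
  have hKle : VectorCalculus.kineticEnergy (u t) ≤ 0 := by linarith
  have hK : VectorCalculus.kineticEnergy (u t) = 0 := le_antisymm hKle (kineticEnergy_nonneg _)
  have hE : eEnergy (u t) = 0 := by
    rw [hLH.eEnergy_eq ht, hK, mul_zero, ENNReal.ofReal_zero]
  have hm : Measurable (u t) := hcont.measurable
  have hmeas : AEMeasurable (fun x => ‖u t x‖ₑ ^ 2) (volume : Measure ℝ³) :=
    (hm.enorm.pow_const 2).aemeasurable
  have hae : (fun x => ‖u t x‖ₑ ^ 2) =ᵐ[volume] 0 := (lintegral_eq_zero_iff' hmeas).1 hE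
  have hae' : u t =ᵐ[volume] 0 := by
    filter_upwards [hae] with x hx
    simpa using hx
  exact Continuous.ae_eq_iff_eq volume hcont continuous_const |>.1 hae'

/-- **The inner hypothesis HOLDS at the zero datum** (for `ν ≥ 0`): every classical Leray–Hopf
field from `0` is identically `0` on `[0,T)`, so `M = 0` bounds all planar energies. -/
theorem planarHyp_zero {ν : ℝ} (hν : 0 ≤ ν) : PlanarHyp ν 0 := by
  intro T hT u p hcl hLH h0
  refine ⟨0, fun t ht R c => ?_⟩
  have hLH' : IsLerayHopfOn T ν 0 0 u := by simpa [h0] using hLH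
  have hcont : Continuous (u t) := (hcl.contDiff_velocity ht).continuous
  rw [eq_zero_of_isLerayHopfOn_zero_datum hν hLH' (Ico_subset_Icc_self ht) hcont]
  simp

/-- **Clay (A) holds at the zero datum**: the rest state `u ≡ 0`, `p ≡ 0`. -/
theorem clayA_zero (ν : ℝ) : ClayA ν (0 : ℝ³ → ℝ³) := by
  refine ⟨0, 0, ?_, ?_, ⟨fun t _ x => ?_, fun t _ x => ?_, rfl⟩, ⟨0, by simp, fun t _ => by simp⟩⟩
  · change ContDiffOn ℝ _ (uncurry (0 : ℝ → ℝ³ → ℝ³)) _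
    exact contDiffOn_const
  · change ContDiffOn ℝ _ (uncurry (0 : ℝ → ℝ³ → ℝ)) _
    exact contDiffOn_const
  · simp [Pi.zero_def]
  · simp [NSWave0.divergence]

/-- **The crux instance at `u₀ = 0` is "true → true"** (hypothesis true by `planarHyp_zero`,
conclusion true by `clayA_zero`): the degenerate datum is neither a counterexample nor vacuous. -/
theorem crux_instance_zero {ν : ℝ} (hν : 0 < ν) : PlanarHyp ν 0 ∧ ClayA ν 0 :=
  ⟨planarHyp_zero hν.le, clayA_zero ν⟩

/-! ## §3 LOAD-BEARING: the Leray–Hopf (finite-energy) clause of the inner hypothesis -/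

/-- The inner hypothesis with the Leray–Hopf clause DROPPED. -/
def PlanarHypWithoutLH (ν : ℝ) (u₀ : ℝ³ → ℝ³) : Prop :=
  ∀ (T : ℝ), 0 < T → ∀ (u : ℝ → ℝ³ → ℝ³) (p : ℝ → ℝ³ → ℝ),
    IsClassicalNSSolutionOn (Set.Ico 0 T) ν 0 u p → u 0 = u₀ →
    ∃ M : ℝ, ∀ t ∈ Set.Ico 0 T, ∀ (R : ℝ³ ≃ₗᵢ[ℝ] ℝ³) (c : ℝ), planarEnergy (u t) R c ≤ ENNReal.ofReal M

/-- The crux with the Leray–Hopf clause dropped from its inner hypothesis. -/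
def CruxWithoutLH : Prop :=
  ∀ ν : ℝ, 0 < ν → ∀ u₀ : ℝ³ → ℝ³, ContDiff ℝ (⊤ : ℕ∞) u₀ → NSWave0.IsDivFree u₀ →
    HasRapidSpatialDecay u₀ → PlanarHypWithoutLH ν u₀ → ClayA ν u₀

/-- The accelerating Galilean drift: velocity `u(t,x) = t • e`. -/
def drift (e : ℝ³) : ℝ → ℝ³ → ℝ³ := fun t _ => t • e

/-- Its pressure `p(t,x) = -⟪e, x⟫` (so that `-∇p = e = ∂ₜu`). -/
def driftPressure (e : ℝ³) : ℝ → ℝ³ → ℝ := fun _ x => -⟪e, x⟫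

/-- The gradient of `x ↦ -⟪e, x⟫` is `-e`. -/
theorem gradient_driftPressure (e x : ℝ³) (t : ℝ) : gradient (driftPressure e t) x = -e := by
  have h : HasFDerivAt (fun y : ℝ³ => -⟪e, y⟫) (-(innerSL ℝ e)) x :=
    ((innerSL ℝ e).hasFDerivAt).neg
  unfold driftPressure
  rw [gradient, h.fderiv]
  apply (InnerProductSpace.toDual ℝ ℝ³).injective
  rw [LinearIsometryEquiv.apply_symm_apply]
  ext y
  simp [InnerProductSpace.toDual_apply_apply]

/-- **The drift is a classical solution of unforced NS on `[0,T)` (any `ν`)**: `∂ₜu = e`,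
`(u·∇)u = 0`, `Δu = 0`, `∇p = -e`, `div u = 0` (Serrin's parasitic solutions, KNSS 2009 §1). -/
theorem isClassicalNSSolutionOn_drift (ν T : ℝ) (e : ℝ³) :
    IsClassicalNSSolutionOn (Ico 0 T) ν 0 (drift e) (driftPressure e) where
  smooth_velocity := by
    unfold IsSmoothSpaceTimeOn drift
    exact (contDiff_fst.smul contDiff_const).contDiffOn
  smooth_pressure := by
    unfold IsSmoothSpaceTimeOn driftPressure
    exact (contDiff_const.inner ℝ contDiff_snd).neg.contDiffOn
  momentum t ht x := by
    have h1 : timeDerivWithin (Ico 0 T) (drift e) t x = e := by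
      rw [timeDerivWithin_apply]
      have hd : HasDerivWithinAt (fun s : ℝ => s • e) ((1 : ℝ) • e) (Ico 0 T) t :=
        ((hasDerivAt_id t).smul_const e).hasDerivWithinAt
      unfold drift
      rw [hd.derivWithin (uniqueDiffOn_Ico 0 T t ht), one_smul]
    have hdr : drift e t = fun _ : ℝ³ => t • e := rfl
    have h2 : convect (drift e t) (drift e t) x = 0 := by
      simp only [convect]
      rw [hdr]
      simp
    have h3 : (Δ (drift e t)) x = 0 := by
      rw [hdr, InnerProductSpace.laplacian_const]
      rfl
    rw [h1, h2, h3, gradient_driftPressure]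
    simp
  divFree t ht x := by
    have hdr : drift e t = fun _ : ℝ³ => t • e := rfl
    simp only [VectorCalculus.divergence]
    rw [hdr]
    simp

/-- The drift starts from the zero datum. -/
@[simp] theorem drift_zero (e : ℝ³) : drift e 0 = 0 := by
  funext x; simp [drift]

/-- **Infinite planar energy**: at a time `t ≠ 0` and for `e ≠ 0` the drift has planar energy `⊤`
through every plane (a nonzero constant integrated over `ℝ²`). -/
theorem planarEnergy_drift {e : ℝ³} (he : e ≠ 0) {t : ℝ} (ht : t ≠ 0) (R : ℝ³ ≃ₗᵢ[ℝ] ℝ³)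
    (c : ℝ) : planarEnergy (drift e t) R c = ⊤ := by
  have hne : ‖t • e‖ₑ ^ 2 ≠ 0 := by
    apply pow_ne_zero
    rw [enorm_ne_zero]
    exact smul_ne_zero ht he
  simp only [planarEnergy, drift, lintegral_const, measure_univ_of_isAddLeftInvariant]
  exact ENNReal.mul_top hne

/-- A nonzero vector of `ℝ³`. -/
def e₀ : ℝ³ := EuclideanSpace.single 0 1

theorem e₀_ne_zero : e₀ ≠ 0 := by
  intro h
  have := congrArg (fun v : ℝ³ => v 0) h
  simp [e₀] at this

/-- **Without the Leray–Hopf clause the inner hypothesis FAILS at the zero datum**: the drift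
`t • e₀` from `0` has unbounded (indeed infinite) planar energy on `[0,1)`. -/
theorem not_planarHypWithoutLH_zero (ν : ℝ) : ¬ PlanarHypWithoutLH ν 0 := by
  intro h
  obtain ⟨M, hM⟩ := h 1 one_pos (drift e₀) (driftPressure e₀)
    (isClassicalNSSolutionOn_drift ν 1 e₀) (drift_zero e₀)
  have h12 : (1 / 2 : ℝ) ∈ Ico (0 : ℝ) 1 := ⟨by norm_num, by norm_num⟩
  have hle := hM (1 / 2) h12 (LinearIsometryEquiv.refl ℝ ℝ³) 0
  rw [planarEnergy_drift e₀_ne_zero (by norm_num) _ 0] at hle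
  exact ENNReal.ofReal_ne_top (top_le_iff.1 hle)

/-- **Hence the LH-free crux holds VACUOUSLY at `u₀ = 0`** (its inner hypothesis is false there);
by Galilean invariance (`u ↦ u(t, x - B(t)) + B'(t)`, `B(0) = B'(0) = 0`) the same drift rides on
the local smooth solution from ANY datum, so `CruxWithoutLH` is vacuous at every datum admitting a
local classical solution: the finite-energy clause is load-bearing for NON-VACUITY, and it is
present in the crux as written. -/
theorem cruxWithoutLH_vacuous_at_zero (ν : ℝ) : PlanarHypWithoutLH ν 0 → ClayA ν 0 :=
  fun h => (not_planarHypWithoutLH_zero ν h).elim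

end Summit.NavierStokesRegularity.NavierStokesRegularity.Cruxes.BoundedPlanarEnergyRegularity.Disproof

end
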